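import Literature.NumberTheory.LFunctions.MertensErrorTermsMeanValueRHPiLi
import Literature.NumberTheory.LFunctions.MertensErrorTermsMeanValueRHLandau
import Literature.NumberTheory.LFunctions.LittlewoodOscillationInputsPiProofs
import Literature.NumberTheory.LFunctions.LogIntegralBridgeProofs
import HarnessLib

/-!
# RH-EQUIVALENT literature, proof layer (RH-free Mellin groundwork) — «nothing here bears on the truth of RH»
# Zhao 2025, Theorem 1 (`i = 2`), necessity half: the Mellin transform of `x ∫_x^∞ (π − li)/t²`

Proof companion of `MertensErrorTermsMeanValueRH.lean` (T. Zhao, Res. Number Theory 11 (2025) 62 =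
arXiv:2411.18903 [bib: `Zhao2025MertensMean`]); theorems only, no definition, no named fact; everything here is RH-FREE.
§3 of the source ("Proof of Theorem 1, necessity") treats `i = 2` by Landau's theorem applied to
`A₂(X) = X^{Θ−1−ε} + ∫_X^∞ (Π(x) − li(x)) x⁻² dx` through its Mellin transform «`∫_2^∞ A₂(x) x^{-s} dx` … and then proceed
as before», with Lemma 7 (2) (`∫_2^∞ Π x^{-s-1} = (log ζ(s))/s`, `∫_2^∞ li x^{-s-1} = (−log(s−1) + r(s))/s`). This file
provides the RH-free transform identities for the tree's integrated error term (2.5)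
`∫₂^X E₂ = 2T₂(2) − X T₂(X)`, `T₂(y) = ∫_y^∞ (π − li)/t²` (`Zhao2025.integral_E₂_eq`), in the normalisation
`F(s) = ∫_1^∞ g(x) x^{-s-1} dx` of the tree's Landau lemma (`Landau.mellinIoi`) and with the log-free pieces of the tree's
proof of MV Thm 15.2 for `π` (`PiOmega.mellinIoi_primePowerPi`, `PiOmega.mellinIoi_truncLi`):

* `Zhao2025.measurable_piLiTail_max`, `Zhao2025.abs_piLiTail_le`, `Zhao2025.integrableOn_mul_piLiTail_rpow` — `x T₂(max(x,2))`
  is measurable, `≪ x`, and its transform converges absolutely for `σ > 1`; `Zhao2025.integrableOn_mul_piLiTail_rpow_one` —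
  and at `σ = 1` (`T₂(y) ≪ 1/log² y` from the prime number theorem with error `x/log³ x`);
* `Zhao2025.mellinIoi_mul_piLiTail` (Fubini) — for `σ > 1`,
  `∫_1^∞ x T₂(max(x,2)) x^{-s-1} dx = (M₂(s) − T₂(2))/(1 − s)`, `M₂(s) = ∫_2^∞ (π − li)(t) t^{-s-1} dt`;
* `Zhao2025.mellinIoi_piLi_eq` — `M₂(s) = D(s)/s − N(s) − E(s)/s − li(2)·2^{-s}/s` (`σ > 1`), where `D = Σ Λ(n)/(log n) n^{-s}`
  (PiOmega's log-free `log ζ`), `E(s) = ∫_2^∞ x^{-s}dx/log x` (PiOmega's `ℓ`-transform), and `N(s) = ∫_1^∞ (Π − π) x^{-s-1} dx`;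
* `Zhao2025.differentiableOn_mellinIoi_primePowerPi_sub_primeCounting` — `N` is holomorphic on `Re s > 1/2` (`0 ≤ Π − π ≪ √x`).

The Landau step itself (the analogue of `MertensErrorTermsMeanValueRHLandau.lean` for `E₂`, with the removable
singularity at `s = 1`) is NOT done here.
-/

noncomputable section

open Complex Filter Topology Set MeasureTheory
open scoped Real Chebyshev

namespace Literature.NumberTheory.LFunctions

namespace Zhao2025

open Landau Nicolas PsiOmega PiOmega ArithmeticFunction

/-! ### The kernel `K = (π − li)/t²` and the tail `T₂(max(x, 2))` -/

/-- Measurability of the kernel `(π(t) − li(t))/t²`. [cite: Zhao2025MertensMean, §2 (2.5)] -/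
theorem measurable_piLiKernel :
    Measurable fun t : ℝ => ((Nat.primeCounting ⌊t⌋₊ : ℝ) - logIntegral t) / t ^ 2 :=
  (measurable_primeCounting_real.sub measurable_logIntegral).div (measurable_id.pow_const 2)

/-- `|T₂(y)| ≤ A₂ := ∫_2^∞ |K|` for `y ≥ 2`. [cite: Zhao2025MertensMean, §3 (proof of Thm 1, necessity, i = 2)] -/
theorem abs_piLiTail_le {y : ℝ} (hy : 2 ≤ y) :
    |∫ t in Ioi y, ((Nat.primeCounting ⌊t⌋₊ : ℝ) - logIntegral t) / t ^ 2| ≤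
      ∫ t in Ioi (2 : ℝ), |((Nat.primeCounting ⌊t⌋₊ : ℝ) - logIntegral t) / t ^ 2| := by
  calc |∫ t in Ioi y, ((Nat.primeCounting ⌊t⌋₊ : ℝ) - logIntegral t) / t ^ 2|
      ≤ ∫ t in Ioi y, |((Nat.primeCounting ⌊t⌋₊ : ℝ) - logIntegral t) / t ^ 2| := abs_integral_le_integral_abs
    _ ≤ ∫ t in Ioi (2 : ℝ), |((Nat.primeCounting ⌊t⌋₊ : ℝ) - logIntegral t) / t ^ 2| :=
        setIntegral_mono_set integrableOn_piLiKernel.abs (Eventually.of_forall fun _ => abs_nonneg _)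
          (Ioi_subset_Ioi hy).eventuallyLE

/-- `x ↦ T₂(max(x, 2))` is measurable (Fubini measurability of a parametric integral).
[cite: Zhao2025MertensMean, §3 (proof of Thm 1, necessity, i = 2)] -/
theorem measurable_piLiTail_max :
    Measurable fun x : ℝ => ∫ t in Ioi (max x 2), ((Nat.primeCounting ⌊t⌋₊ : ℝ) - logIntegral t) / t ^ 2 := by
  set K : ℝ → ℝ := fun t => ((Nat.primeCounting ⌊t⌋₊ : ℝ) - logIntegral t) / t ^ 2 with hK
  set F : ℝ → ℝ → ℝ := fun x t => if max x 2 < t then K t else 0 with hF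
  have hFm : Measurable (Function.uncurry F) := by
    have : Function.uncurry F = fun p : ℝ × ℝ => if max p.1 2 < p.2 then K p.2 else 0 := by
      funext p; rfl
    rw [this]
    exact Measurable.ite (measurableSet_lt (measurable_fst.max measurable_const) measurable_snd)
      (measurable_piLiKernel.comp measurable_snd) measurable_const
  have heq : (fun x => ∫ t, F x t) = fun x : ℝ => ∫ t in Ioi (max x 2), K t := by
    funext x
    rw [← integral_indicator measurableSet_Ioi]
    rfl
  rw [← heq]
  exact (hFm.stronglyMeasurable.integral_prod_right (ν := volume)).measurable

/-- `|x T₂(max(x,2))| ≤ A₂ x` for `x ≥ 0`. [cite: Zhao2025MertensMean, §3 (proof of Thm 1, necessity, i = 2)] -/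
theorem abs_mul_piLiTail_le {x : ℝ} (hx : 0 ≤ x) :
    |x * ∫ t in Ioi (max x 2), ((Nat.primeCounting ⌊t⌋₊ : ℝ) - logIntegral t) / t ^ 2| ≤
      (∫ t in Ioi (2 : ℝ), |((Nat.primeCounting ⌊t⌋₊ : ℝ) - logIntegral t) / t ^ 2|) * x := by
  rw [abs_mul, abs_of_nonneg hx, mul_comm]
  exact mul_le_mul_of_nonneg_right (abs_piLiTail_le (le_max_right _ _)) hx

/-- Absolute convergence of `∫_1^∞ x T₂(max(x,2)) x^{-σ-1} dx` for `σ > 1`.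
[cite: Zhao2025MertensMean, §3 (proof of Thm 1, necessity, i = 2)] -/
theorem integrableOn_mul_piLiTail_rpow {σ : ℝ} (hσ : 1 < σ) :
    IntegrableOn (fun x : ℝ => (x * ∫ t in Ioi (max x 2), ((Nat.primeCounting ⌊t⌋₊ : ℝ) - logIntegral t) / t ^ 2) *
      x ^ (-(σ + 1))) (Ioi 1) := by
  set A : ℝ := ∫ t in Ioi (2 : ℝ), |((Nat.primeCounting ⌊t⌋₊ : ℝ) - logIntegral t) / t ^ 2| with hA
  refine Integrable.mono'
    ((integrableOn_Ioi_rpow_of_lt (show -σ < -1 by linarith) zero_lt_one).const_mul A)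
    (((measurable_id.mul measurable_piLiTail_max).mul (measurable_id.pow_const _)).aestronglyMeasurable) ?_
  rw [ae_restrict_iff' measurableSet_Ioi]
  refine ae_of_all _ fun x hx => ?_
  have hx1 : 1 < x := hx
  have hx0 : 0 < x := by linarith
  rw [Real.norm_eq_abs, abs_mul, abs_of_nonneg (Real.rpow_nonneg hx0.le _)]
  calc |x * ∫ t in Ioi (max x 2), ((Nat.primeCounting ⌊t⌋₊ : ℝ) - logIntegral t) / t ^ 2| * x ^ (-(σ + 1))
      ≤ A * x * x ^ (-(σ + 1)) := mul_le_mul_of_nonneg_right (abs_mul_piLiTail_le hx0.le) (Real.rpow_nonneg hx0.le _)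
    _ = A * x ^ (-σ) := by
        rw [show (-(σ + 1)) = -σ - 1 by ring, Real.rpow_sub hx0, Real.rpow_one]
        field_simp

/-- **`T₂(y) ≪ 1/log² y`**: there are `Y ≥ 2` and `C` with `|T₂(y)| ≤ C/log² y` for `y ≥ Y` (from
`|π − li| ≤ C' x/log³ x`, the prime number theorem in the tree's `AriasDeReyna2011Primes.exists_abs_primeCounting_sub_logIntegral_le`,
and `∫_y^∞ dt/(t log³ t) = 1/(2 log² y)`). [cite: Zhao2025MertensMean, §3 (proof of Thm 1, necessity, i = 2)] -/
theorem exists_abs_piLiTail_le_div_log_sq :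
    ∃ Y C : ℝ, 2 ≤ Y ∧ 0 ≤ C ∧ ∀ y : ℝ, Y ≤ y →
      |∫ t in Ioi y, ((Nat.primeCounting ⌊t⌋₊ : ℝ) - logIntegral t) / t ^ 2| ≤ C / Real.log y ^ 2 := by
  obtain ⟨X, C, hX2, hC0, hC⟩ := AriasDeReyna2011Primes.exists_abs_primeCounting_sub_logIntegral_le 3
  refine ⟨X, C / 2, hX2, by positivity, fun y hy => ?_⟩
  have hy2 : 2 ≤ y := hX2.trans hy
  have hy0 : 0 < y := by linarith
  have hly : 0 < Real.log y := Real.log_pos (by linarith)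
  -- majorant `C/(t log³ t)` with primitive `−(C/2)/log² t`
  have hderiv : ∀ t ∈ Ici y, HasDerivAt (fun u : ℝ => -(C / 2) * (Real.log u ^ 2)⁻¹) (C / (t * Real.log t ^ 3)) t := by
    intro t ht
    have ht' : y ≤ t := ht
    have ht0 : t ≠ 0 := by linarith
    have hl : Real.log t ≠ 0 := (Real.log_pos (by linarith)).ne'
    have hlog2 : HasDerivAt (fun u : ℝ => Real.log u ^ 2) (2 * Real.log t * t⁻¹) t := by
      have h := (Real.hasDerivAt_log ht0).mul (Real.hasDerivAt_log ht0)
      have e : (Real.log * Real.log : ℝ → ℝ) = fun u => Real.log u ^ 2 := by funext u; simp [pow_two]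
      rw [e] at h
      exact h.congr_deriv (by ring)
    have h := (hlog2.inv (pow_ne_zero _ hl)).const_mul (-(C / 2))
    refine h.congr_deriv ?_
    field_simp
  have hlim : Tendsto (fun u : ℝ => -(C / 2) * (Real.log u ^ 2)⁻¹) atTop (𝓝 0) := by
    have h1 : Tendsto (fun u : ℝ => Real.log u ^ 2) atTop atTop :=
      (tendsto_pow_atTop two_ne_zero).comp Real.tendsto_log_atTop
    have h2 := (tendsto_inv_atTop_zero.comp h1).const_mul (-(C / 2))
    rw [mul_zero] at h2
    exact h2
  have hmaj_int : IntegrableOn (fun t : ℝ => C / (t * Real.log t ^ 3)) (Ioi y) := by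
    refine integrableOn_Ioi_deriv_of_nonneg ((hderiv y (mem_Ici.2 le_rfl)).continuousAt.continuousWithinAt)
      (fun t ht => hderiv t (mem_Ici.2 (le_of_lt (mem_Ioi.1 ht)))) (fun t ht => ?_) hlim
    have ht1 : 1 < t := by linarith [mem_Ioi.1 ht]
    have := Real.log_pos ht1
    positivity
  have hmaj_val : ∫ t in Ioi y, C / (t * Real.log t ^ 3) = C / 2 / Real.log y ^ 2 := by
    rw [integral_Ioi_of_hasDerivAt_of_tendsto' hderiv hmaj_int hlim]
    field_simp
    ring
  calc |∫ t in Ioi y, ((Nat.primeCounting ⌊t⌋₊ : ℝ) - logIntegral t) / t ^ 2|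
      ≤ ∫ t in Ioi y, |((Nat.primeCounting ⌊t⌋₊ : ℝ) - logIntegral t) / t ^ 2| := abs_integral_le_integral_abs
    _ ≤ ∫ t in Ioi y, C / (t * Real.log t ^ 3) := by
        refine setIntegral_mono_on (integrableOn_piLiKernel.mono_set (Ioi_subset_Ioi hy2)).abs hmaj_int
          measurableSet_Ioi fun t ht => ?_
        have hty : y < t := ht
        have ht0 : 0 < t := hy0.trans hty
        have hlt : 0 < Real.log t := Real.log_pos (by linarith)
        rw [abs_div, abs_of_pos (by positivity : (0 : ℝ) < t ^ 2), div_le_div_iff₀ (by positivity) (by positivity)]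
        have h := hC t (hy.trans hty.le)
        calc |(Nat.primeCounting ⌊t⌋₊ : ℝ) - logIntegral t| * (t * Real.log t ^ 3)
            ≤ C * (t / Real.log t ^ 3) * (t * Real.log t ^ 3) := mul_le_mul_of_nonneg_right h (by positivity)
          _ = C * t ^ 2 := by field_simp
    _ = C / 2 / Real.log y ^ 2 := hmaj_val

/-- Absolute convergence of `∫_1^∞ x T₂(max(x,2)) x^{-σ-1} dx` at `σ = 1` (`|T₂(y)| ≤ A₂` on `[2, Y]`, `≤ C/log² y` beyond,
and `∫ dx/(x log² x) < ∞`): the abscissa of absolute convergence of the transform of the integrated `E₂` is `≤ 1`.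
[cite: Zhao2025MertensMean, §3 (proof of Thm 1, necessity, i = 2)] -/
theorem integrableOn_mul_piLiTail_rpow_one :
    IntegrableOn (fun x : ℝ => (x * ∫ t in Ioi (max x 2), ((Nat.primeCounting ⌊t⌋₊ : ℝ) - logIntegral t) / t ^ 2) *
      x ^ (-((1 : ℝ) + 1))) (Ioi 1) := by
  obtain ⟨Y, C, hY2, hC0, hC⟩ := exists_abs_piLiTail_le_div_log_sq
  set A : ℝ := ∫ t in Ioi (2 : ℝ), |((Nat.primeCounting ⌊t⌋₊ : ℝ) - logIntegral t) / t ^ 2| with hA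
  have hA0 : 0 ≤ A := by positivity
  have hmeas : Measurable fun x : ℝ => (x * ∫ t in Ioi (max x 2), ((Nat.primeCounting ⌊t⌋₊ : ℝ) - logIntegral t) / t ^ 2) *
      x ^ (-((1 : ℝ) + 1)) := (measurable_id.mul measurable_piLiTail_max).mul (measurable_id.pow_const _)
  rw [← Ioc_union_Ioi_eq_Ioi (by linarith : (1 : ℝ) ≤ Y)]
  refine IntegrableOn.union ?_ ?_
  · -- on `(1, Y]`: bounded by `A`
    refine Measure.integrableOn_of_bounded (M := A) measure_Ioc_lt_top.ne hmeas.aestronglyMeasurable ?_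
    rw [ae_restrict_iff' measurableSet_Ioc]
    refine Eventually.of_forall fun x hx => ?_
    have hx0 : 0 < x := by linarith [hx.1]
    have hx1 : 1 ≤ x := hx.1.le
    rw [Real.norm_eq_abs, abs_mul, abs_of_nonneg (Real.rpow_nonneg hx0.le _)]
    have hr : x ^ (-((1 : ℝ) + 1)) = (x ^ 2)⁻¹ := by
      rw [Real.rpow_neg hx0.le, show ((1 : ℝ) + 1) = 2 by norm_num, Real.rpow_two]
    rw [hr]
    calc |x * ∫ t in Ioi (max x 2), ((Nat.primeCounting ⌊t⌋₊ : ℝ) - logIntegral t) / t ^ 2| * (x ^ 2)⁻¹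
        ≤ A * x * (x ^ 2)⁻¹ := mul_le_mul_of_nonneg_right (abs_mul_piLiTail_le hx0.le) (by positivity)
      _ = A / x := by field_simp
      _ ≤ A := div_le_self hA0 hx1
  · -- on `(Y, ∞)`: bounded by `C/(x log² x)`
    refine Integrable.mono' ((Mertens.integrableOn_inv_div_log_sq.mono_set (Ioi_subset_Ioi hY2)).const_mul C)
      hmeas.aestronglyMeasurable ?_
    rw [ae_restrict_iff' measurableSet_Ioi]
    refine Eventually.of_forall fun x hx => ?_
    have hxY : Y < x := hx
    have hx0 : 0 < x := by linarith
    have hx2 : 2 ≤ x := hY2.trans hxY.le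
    rw [Real.norm_eq_abs, abs_mul, abs_of_nonneg (Real.rpow_nonneg hx0.le _), max_eq_left hx2, abs_mul,
      abs_of_pos hx0]
    have hr : x ^ (-((1 : ℝ) + 1)) = (x ^ 2)⁻¹ := by
      rw [Real.rpow_neg hx0.le, show ((1 : ℝ) + 1) = 2 by norm_num, Real.rpow_two]
    rw [hr]
    have hT := hC x hxY.le
    calc x * |∫ t in Ioi x, ((Nat.primeCounting ⌊t⌋₊ : ℝ) - logIntegral t) / t ^ 2| * (x ^ 2)⁻¹
        ≤ x * (C / Real.log x ^ 2) * (x ^ 2)⁻¹ := by gcongr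
      _ = C * (x⁻¹ / Real.log x ^ 2) := by field_simp

/-! ### The transform of `x T₂(max(x,2))` on `σ > 1` (Fubini) -/

/-- **Fubini step for `i = 2`**: for `σ > 1`,
`∫_1^∞ x T₂(max(x,2)) x^{-s-1} dx = (M₂(s) − T₂(2))/(1 − s)`, `M₂(s) = ∫_2^∞ (π(t) − li(t)) t^{-s-1} dt`, `T₂(2) = ∫_2^∞ (π − li)/t²`
(swap `∫_1^∞ x^{-s} ∫_{max(x,2)}^∞ K dt dx = ∫_2^∞ K(t) ∫_1^t x^{-s} dx dt`, `∫_1^t x^{-s} dx = (t^{1−s} − 1)/(1 − s)`) — the source's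
transform of `A₂`. [cite: Zhao2025MertensMean, §3 (the transform of A₂)] -/
theorem mellinIoi_mul_piLiTail {s : ℂ} (hs : 1 < s.re) :
    mellinIoi (fun x : ℝ => x * ∫ t in Ioi (max x 2), ((Nat.primeCounting ⌊t⌋₊ : ℝ) - logIntegral t) / t ^ 2) s =
      ((∫ t in Ioi (2 : ℝ), (((Nat.primeCounting ⌊t⌋₊ : ℝ) - logIntegral t : ℝ) : ℂ) * (t : ℂ) ^ (-(s + 1))) -
        ((∫ t in Ioi (2 : ℝ), ((Nat.primeCounting ⌊t⌋₊ : ℝ) - logIntegral t) / t ^ 2 : ℝ) : ℂ)) / (1 - s) := by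
  set K : ℝ → ℝ := fun t => ((Nat.primeCounting ⌊t⌋₊ : ℝ) - logIntegral t) / t ^ 2 with hK
  set μ : Measure ℝ := volume.restrict (Ioi (1 : ℝ)) with hμ
  set ν : Measure ℝ := volume.restrict (Ioi (2 : ℝ)) with hν
  have hs1 : (1 : ℂ) - s ≠ 0 := by
    intro h; have := congrArg Complex.re h; simp at this; linarith
  -- the double integrand
  set F : ℝ → ℝ → ℂ := fun x t => if max x 2 < t then (K t : ℂ) * (x : ℂ) ^ (-s) else 0 with hF
  have hFm : Measurable (Function.uncurry F) := by
    have : Function.uncurry F =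
        fun p : ℝ × ℝ => if max p.1 2 < p.2 then (K p.2 : ℂ) * (p.1 : ℂ) ^ (-s) else 0 := by
      funext p; rfl
    rw [this]
    exact Measurable.ite (measurableSet_lt (measurable_fst.max measurable_const) measurable_snd)
      ((Complex.measurable_ofReal.comp (measurable_piLiKernel.comp measurable_snd)).mul
        ((Complex.measurable_ofReal.comp measurable_fst).pow_const _)) measurable_const
  have hKi : Integrable K ν := integrableOn_piLiKernel
  have hpi : Integrable (fun x : ℝ => x ^ (-s.re)) μ :=
    integrableOn_Ioi_rpow_of_lt (by linarith) zero_lt_one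
  have hFint : Integrable (Function.uncurry F) (μ.prod ν) := by
    refine Integrable.mono' (hpi.mul_prod hKi.norm) hFm.aestronglyMeasurable ?_
    rw [hμ, hν, Measure.prod_restrict, ae_restrict_iff' (measurableSet_Ioi.prod measurableSet_Ioi)]
    refine Eventually.of_forall fun p hp => ?_
    have hx : 1 < p.1 := hp.1
    have hx0 : 0 < p.1 := by linarith
    simp only [Function.uncurry, hF]
    split_ifs
    · rw [norm_mul, Complex.norm_cpow_eq_rpow_re_of_pos hx0, Complex.neg_re, Complex.norm_real, mul_comm]
    · rw [norm_zero]
      exact mul_nonneg (Real.rpow_nonneg hx0.le _) (norm_nonneg (K p.2))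
  have hswap := integral_integral_swap hFint
  -- inner integral in `t`: `T₂(max x 2) x^{-s}`
  have hL : ∀ x ∈ Ioi (1 : ℝ), ∫ t, F x t ∂ν = ((∫ t in Ioi (max x 2), K t : ℝ) : ℂ) * (x : ℂ) ^ (-s) := by
    intro x _
    have : ∀ t, F x t = (Ioi (max x 2)).indicator (fun t => (K t : ℂ) * (x : ℂ) ^ (-s)) t := by
      intro t; simp only [hF, indicator, mem_Ioi]
    simp_rw [this]
    rw [hν, integral_indicator measurableSet_Ioi, Measure.restrict_restrict measurableSet_Ioi,
      Ioi_inter_Ioi, sup_eq_left.2 (le_max_right x 2), integral_mul_const, integral_complex_ofReal]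
  -- inner integral in `x`: `K(t) (t^{1-s} − 1)/(1 − s)` for `t > 2`
  have hR : ∀ t ∈ Ioi (2 : ℝ), ∫ x, F x t ∂μ = (K t : ℂ) * (((t : ℂ) ^ (1 - s) - 1) / (1 - s)) := by
    intro t ht
    have ht2 : 2 < t := ht
    have ht1 : 1 < t := by linarith
    have : ∀ x, x ∈ Ioi (1 : ℝ) → F x t = (Iio t).indicator (fun x => (K t : ℂ) * (x : ℂ) ^ (-s)) x := by
      intro x hx
      have hx1 : 1 < x := hx
      by_cases hxt : x < t
      · have hm : max x 2 < t := max_lt hxt ht2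
        simp only [hF, if_pos hm, indicator, mem_Iio, if_pos hxt]
      · have hm : ¬ max x 2 < t := fun h => hxt (lt_of_le_of_lt (le_max_left _ _) h)
        simp only [hF, if_neg hm, indicator, mem_Iio, if_neg hxt]
    rw [hμ, setIntegral_congr_fun measurableSet_Ioi this, integral_indicator measurableSet_Iio,
      Measure.restrict_restrict measurableSet_Iio]
    have hset : Iio t ∩ Ioi 1 = Ioo 1 t := by
      ext x; simp only [mem_inter_iff, mem_Iio, mem_Ioi, mem_Ioo]; exact and_comm
    rw [hset, integral_const_mul, ← integral_Ioc_eq_integral_Ioo, ← intervalIntegral.integral_of_le ht1.le,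
      integral_cpow (Or.inr ⟨fun h => hs1 (by linear_combination h), by
        rw [uIcc_of_le ht1.le]; exact fun h => by linarith [h.1]⟩)]
    push_cast
    rw [show -s + 1 = 1 - s by ring, one_cpow]
  -- integrability of the `(π − li)`-Mellin integrand on `(2, ∞)`: `|K t · t^{1−s}| ≤ |K t|`
  have hKs : Integrable (fun t : ℝ => (K t : ℂ) * (t : ℂ) ^ (1 - s)) ν := by
    refine Integrable.mono' hKi.norm ((Complex.measurable_ofReal.comp measurable_piLiKernel).mul
      (Complex.measurable_ofReal.pow_const _)).aestronglyMeasurable ?_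
    rw [hν, ae_restrict_iff' measurableSet_Ioi]
    refine Eventually.of_forall fun t ht => ?_
    have ht2 : 2 < t := ht
    have ht0 : 0 < t := by linarith
    rw [norm_mul, Complex.norm_real, Complex.norm_cpow_eq_rpow_re_of_pos ht0, Complex.sub_re, Complex.one_re]
    have : t ^ (1 - s.re) ≤ 1 := Real.rpow_le_one_of_one_le_of_nonpos (by linarith) (by linarith)
    exact le_trans (mul_le_mul_of_nonneg_left this (norm_nonneg _)) (by rw [mul_one])
  have hKi' : Integrable (fun t : ℝ => (K t : ℂ)) ν := hKi.ofReal
  calc mellinIoi (fun x : ℝ => x * ∫ t in Ioi (max x 2), K t) s = ∫ x, ∫ t, F x t ∂ν ∂μ := by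
        rw [mellinIoi, hμ]
        refine setIntegral_congr_fun measurableSet_Ioi fun x hx => ?_
        rw [hL x hx]
        have hx0 : (x : ℂ) ≠ 0 := by exact_mod_cast (zero_lt_one.trans hx).ne'
        push_cast
        rw [show -(s + 1) = -s + (-1 : ℂ) by ring, Complex.cpow_add _ _ hx0, Complex.cpow_neg_one]
        field_simp
    _ = ∫ t, ∫ x, F x t ∂μ ∂ν := hswap
    _ = ∫ t in Ioi (2 : ℝ), (1 - s)⁻¹ * ((K t : ℂ) * (t : ℂ) ^ (1 - s) - (K t : ℂ)) := by
        rw [hν]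
        refine setIntegral_congr_fun measurableSet_Ioi fun t ht => ?_
        rw [hR t ht]
        field_simp
    _ = ((∫ t in Ioi (2 : ℝ), (((Nat.primeCounting ⌊t⌋₊ : ℝ) - logIntegral t : ℝ) : ℂ) * (t : ℂ) ^ (-(s + 1))) -
          ((∫ t in Ioi (2 : ℝ), K t : ℝ) : ℂ)) / (1 - s) := by
        have e : ∫ t in Ioi (2 : ℝ), (K t : ℂ) * (t : ℂ) ^ (1 - s) =
            ∫ t in Ioi (2 : ℝ), (((Nat.primeCounting ⌊t⌋₊ : ℝ) - logIntegral t : ℝ) : ℂ) * (t : ℂ) ^ (-(s + 1)) := by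
          refine setIntegral_congr_fun measurableSet_Ioi fun t ht => ?_
          have ht0 : (t : ℂ) ≠ 0 := by exact_mod_cast (two_pos.trans ht).ne'
          simp only [hK]
          push_cast
          rw [show -(s + 1) = (1 - s) - 2 by ring, Complex.cpow_sub (1 - s) 2 ht0, Complex.cpow_two]
          field_simp
        rw [integral_const_mul, integral_sub hKs hKi', integral_complex_ofReal, e, div_eq_inv_mul]

/-! ### The pieces of `M₂(s) = ∫_2^∞ (π − li) t^{-s-1} dt`: `Π`, `Π − π`, `Li`, `li(2)` -/

/-- `0 ≤ Π − π ≤ C√x` (via `ψ − θ ≤ C√x`): integrability of `(Π − π) x^{-σ-1}` on `(1, ∞)` for `σ > 1/2`.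
[cite: Zhao2025MertensMean, §1.4 (1.7)] -/
theorem integrableOn_primePowerPi_sub_primeCounting_rpow {σ : ℝ} (hσ : 1 / 2 < σ) :
    IntegrableOn (fun x : ℝ => (∑ n ∈ Finset.Ioc 0 ⌊x⌋₊, Λ n / Real.log n - (Nat.primeCounting ⌊x⌋₊ : ℝ)) *
      x ^ (-(σ + 1))) (Ioi 1) := by
  obtain ⟨C, hC⟩ := Chebyshev.psi_sub_theta_le_mul_sqrt
  have hC' : ∀ x : ℝ, 1 < x →
      |∑ n ∈ Finset.Ioc 0 ⌊x⌋₊, Λ n / Real.log n - (Nat.primeCounting ⌊x⌋₊ : ℝ)| ≤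
        max C 0 / Real.log 2 * x ^ (1 / 2 : ℝ) := by
    intro x _
    rw [abs_of_nonneg (primePowerPi_sub_primeCounting_nonneg x), ← Real.sqrt_eq_rpow]
    refine (primePowerPi_sub_primeCounting_le x).trans ?_
    rw [div_mul_eq_mul_div]
    refine div_le_div_of_nonneg_right ?_ (Real.log_pos one_lt_two).le
    exact (hC x).trans (mul_le_mul_of_nonneg_right (le_max_left _ _) (Real.sqrt_nonneg _))
  refine Integrable.mono' ((integrableOn_rpow_rpow (b := 1 / 2) hσ).const_mul (max C 0 / Real.log 2))
    (((measurable_primePowerPi.sub measurable_primeCounting_real).mul (measurable_id.pow_const _)).aestronglyMeasurable) ?_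
  rw [ae_restrict_iff' measurableSet_Ioi]
  refine ae_of_all _ fun x hx => ?_
  have hx1 : 1 < x := hx
  have hx0 : 0 < x := by linarith
  rw [Real.norm_eq_abs, abs_mul, abs_of_nonneg (Real.rpow_nonneg hx0.le _), ← mul_assoc]
  exact mul_le_mul_of_nonneg_right (hC' x hx1) (Real.rpow_nonneg hx0.le _)

/-- **`N(s) = ∫_1^∞ (Π − π) x^{-s-1} dx` is holomorphic on `Re s > 1/2`.** [cite: Zhao2025MertensMean, §1.4 (1.7) and §3] -/
theorem differentiableOn_mellinIoi_primePowerPi_sub_primeCounting :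
    DifferentiableOn ℂ (mellinIoi fun x : ℝ => ∑ n ∈ Finset.Ioc 0 ⌊x⌋₊, Λ n / Real.log n - (Nat.primeCounting ⌊x⌋₊ : ℝ))
      {s : ℂ | 1 / 2 < s.re} :=
  differentiableOn_mellinIoi_of_forall (measurable_primePowerPi.sub measurable_primeCounting_real)
    fun _ hσ' => integrableOn_primePowerPi_sub_primeCounting_rpow hσ'

/-- `π(t) = 0` for `t < 2`. [cite: Zhao2025MertensMean, §1.4 (notation π(x))] -/
theorem primeCounting_real_eq_zero_of_lt_two {t : ℝ} (ht : t < 2) : (Nat.primeCounting ⌊t⌋₊ : ℝ) = 0 := by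
  rcases lt_or_ge t 0 with h | h
  · rw [Nat.floor_of_nonpos h.le, Nat.primeCounting_zero, Nat.cast_zero]
  · have : ⌊t⌋₊ ≤ 1 := by
      have := Nat.floor_le h
      have : (⌊t⌋₊ : ℝ) < 2 := lt_of_le_of_lt this ht
      exact_mod_cast Nat.lt_succ_iff.1 (by exact_mod_cast this)
    interval_cases (⌊t⌋₊) <;> simp [Nat.primeCounting_zero, Nat.primeCounting_one]

/-- The pointwise decomposition on `(1, ∞)`:
`𝟙_{t≥2}(π − li)(t) = Π(t) − (Π − π)(t) − Li(max 2 t) − li(2)·𝟙_{t≥2}` (`li t − li 2 = Li t`).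
[cite: Zhao2025MertensMean, §3 Lemma 7 (2)] -/
theorem indicator_piLi_eq {t : ℝ} (ht : 1 < t) :
    (Ici (2 : ℝ)).indicator (fun u : ℝ => (Nat.primeCounting ⌊u⌋₊ : ℝ) - logIntegral u) t =
      ∑ n ∈ Finset.Ioc 0 ⌊t⌋₊, Λ n / Real.log n -
        (∑ n ∈ Finset.Ioc 0 ⌊t⌋₊, Λ n / Real.log n - (Nat.primeCounting ⌊t⌋₊ : ℝ)) -
        offsetLogIntegral (max 2 t) - logIntegral 2 * (Ici (2 : ℝ)).indicator (fun _ => (1 : ℝ)) t := by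
  by_cases h2 : t ∈ Ici (2 : ℝ)
  · have ht2 : 2 ≤ t := h2
    rw [indicator_of_mem h2, indicator_of_mem h2, max_eq_right ht2, ← logIntegral_sub_logIntegral_two_holds ht]
    ring
  · have ht2 : t < 2 := not_le.1 h2
    rw [indicator_of_notMem h2, indicator_of_notMem h2, truncLi_of_le_two ht2.le,
      primeCounting_real_eq_zero_of_lt_two ht2]
    ring

/-- `∫_1^∞ 𝟙_{x≥2} x^{-s-1} dx = 2^{-s}/s` for `Re s > 0`. [cite: Zhao2025MertensMean, §3 Lemma 7 (2)] -/
theorem mellinIoi_indicator_Ici_two {s : ℂ} (hs : 0 < s.re) :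
    mellinIoi (fun x : ℝ => (Ici (2 : ℝ)).indicator (fun _ => (1 : ℝ)) x) s = (2 : ℂ) ^ (-s) / s := by
  have hs0 : s ≠ 0 := by rintro rfl; simp at hs
  unfold mellinIoi
  have h1 : ∀ x ∈ Ioi (1 : ℝ), (((Ici (2 : ℝ)).indicator (fun _ => (1 : ℝ)) x : ℝ) : ℂ) * (x : ℂ) ^ (-(s + 1)) =
      (Ici (2 : ℝ)).indicator (fun y : ℝ => (y : ℂ) ^ (-(s + 1))) x := by
    intro x _
    by_cases h2 : x ∈ Ici (2 : ℝ)
    · rw [indicator_of_mem h2, indicator_of_mem h2]; push_cast; ring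
    · rw [indicator_of_notMem h2, indicator_of_notMem h2]; push_cast; ring
  rw [setIntegral_congr_fun measurableSet_Ioi h1, setIntegral_indicator measurableSet_Ici,
    inter_eq_right.2 (Ici_subset_Ioi.2 one_lt_two), integral_Ici_eq_integral_Ioi,
    integral_Ioi_cpow_of_lt (by simp; linarith) two_pos]
  rw [show -(s + 1) + 1 = -s by ring]
  push_cast
  field_simp

/-- **The decomposition of `M₂(s) = ∫_2^∞ (π − li)(t) t^{-s-1} dt`** for `σ > 1`:
`M₂(s) = D(s)/s − N(s) − E(s)/s − li(2)·2^{-s}/s` with `D(s) = Σ Λ(n)/(log n) n^{-s}`, `N(s) = ∫_1^∞ (Π − π) x^{-s-1} dx`,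
`E(s) = ∫_2^∞ x^{-s} dx/log x` (the source's Lemma 7 (2): `∫_2^∞ Π x^{-s-1} = log ζ(s)/s`,
`∫_2^∞ li x^{-s-1} = (−log(s−1) + r(s))/s`, in the tree's log-free form). [cite: Zhao2025MertensMean, §3 Lemma 7 (2)] -/
theorem mellinIoi_piLi_eq {s : ℂ} (hs : 1 < s.re) :
    (∫ t in Ioi (2 : ℝ), (((Nat.primeCounting ⌊t⌋₊ : ℝ) - logIntegral t : ℝ) : ℂ) * (t : ℂ) ^ (-(s + 1))) =
      LSeries (fun n : ℕ => ((Λ n / Real.log n : ℝ) : ℂ)) s / s -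
        mellinIoi (fun x : ℝ => ∑ n ∈ Finset.Ioc 0 ⌊x⌋₊, Λ n / Real.log n - (Nat.primeCounting ⌊x⌋₊ : ℝ)) s -
        (mellinIoi (fun x : ℝ => (Ici (2 : ℝ)).indicator (fun y : ℝ => y / Real.log y) x) s) / s -
        (logIntegral 2 : ℂ) * (2 : ℂ) ^ (-s) / s := by
  have hs0 : s ≠ 0 := by rintro rfl; simp at hs; linarith
  -- Step 1: the left side as a `mellinIoi` of the indicator
  have hstep1 : (∫ t in Ioi (2 : ℝ), (((Nat.primeCounting ⌊t⌋₊ : ℝ) - logIntegral t : ℝ) : ℂ) * (t : ℂ) ^ (-(s + 1))) =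
      mellinIoi (fun x : ℝ => (Ici (2 : ℝ)).indicator (fun u : ℝ => (Nat.primeCounting ⌊u⌋₊ : ℝ) - logIntegral u) x) s := by
    unfold mellinIoi
    have h1 : ∀ x ∈ Ioi (1 : ℝ),
        (((Ici (2 : ℝ)).indicator (fun u : ℝ => (Nat.primeCounting ⌊u⌋₊ : ℝ) - logIntegral u) x : ℝ) : ℂ) *
          (x : ℂ) ^ (-(s + 1)) =
        (Ici (2 : ℝ)).indicator
          (fun u : ℝ => (((Nat.primeCounting ⌊u⌋₊ : ℝ) - logIntegral u : ℝ) : ℂ) * (u : ℂ) ^ (-(s + 1))) x := by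
      intro x _
      by_cases h2 : x ∈ Ici (2 : ℝ)
      · rw [indicator_of_mem h2, indicator_of_mem h2]
      · rw [indicator_of_notMem h2, indicator_of_notMem h2]; simp
    rw [setIntegral_congr_fun measurableSet_Ioi h1, setIntegral_indicator measurableSet_Ici,
      inter_eq_right.2 (Ici_subset_Ioi.2 one_lt_two), integral_Ici_eq_integral_Ioi]
  -- Step 2: integrability of the four pieces
  have hP := integrable_ofReal_mul_cpow (g := fun x : ℝ => ∑ n ∈ Finset.Ioc 0 ⌊x⌋₊, Λ n / Real.log n)
    measurable_primePowerPi (σ₁ := (1 + s.re) / 2) (s := s) (integrableOn_primePowerPi_rpow (by linarith)) (by linarith)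
  have hN := integrable_ofReal_mul_cpow
    (g := fun x : ℝ => ∑ n ∈ Finset.Ioc 0 ⌊x⌋₊, Λ n / Real.log n - (Nat.primeCounting ⌊x⌋₊ : ℝ))
    (measurable_primePowerPi.sub measurable_primeCounting_real) (σ₁ := (1 / 2 + s.re) / 2) (s := s)
    (integrableOn_primePowerPi_sub_primeCounting_rpow (by linarith)) (by linarith)
  have hL := integrable_ofReal_mul_cpow (g := fun x : ℝ => offsetLogIntegral (max 2 x)) measurable_truncLi
    (σ₁ := (1 + s.re) / 2) (s := s) (integrableOn_truncLi_rpow (by linarith)) (by linarith)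
  have hI := integrable_ofReal_mul_cpow (g := fun x : ℝ => logIntegral 2 * (Ici (2 : ℝ)).indicator (fun _ => (1 : ℝ)) x)
    ((measurable_const.indicator measurableSet_Ici).const_mul _) (σ₁ := s.re / 2) (s := s)
    (integrableOn_const_mul_rpow _ (integrableOn_rpow_of_le_log (measurable_const.indicator measurableSet_Ici) (C := 1)
      (fun x hx => by
        have hl : 0 ≤ Real.log x := Real.log_nonneg hx.le
        by_cases h2 : x ∈ Ici (2 : ℝ)
        · rw [indicator_of_mem h2, abs_one]; linarith
        · rw [indicator_of_notMem h2, abs_zero]; linarith) (by linarith))) (by linarith)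
  -- Step 3: rewrite pointwise and split
  have hfun : (fun x : ℝ => (Ici (2 : ℝ)).indicator (fun u : ℝ => (Nat.primeCounting ⌊u⌋₊ : ℝ) - logIntegral u) x) =
      fun x : ℝ => (((∑ n ∈ Finset.Ioc 0 ⌊x⌋₊, Λ n / Real.log n) -
        (∑ n ∈ Finset.Ioc 0 ⌊x⌋₊, Λ n / Real.log n - (Nat.primeCounting ⌊x⌋₊ : ℝ))) -
        offsetLogIntegral (max 2 x)) - logIntegral 2 * (Ici (2 : ℝ)).indicator (fun _ => (1 : ℝ)) x := by
    funext x
    rcases le_or_gt x 1 with hx | hx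
    · have h2 : x ∉ Ici (2 : ℝ) := fun h => by have : (2 : ℝ) ≤ x := h; linarith
      rw [indicator_of_notMem h2, indicator_of_notMem h2, truncLi_of_le_two (by linarith),
        primeCounting_real_eq_zero_of_lt_two (by linarith)]
      ring
    · exact indicator_piLi_eq hx
  rw [hstep1, hfun, mellinIoi_sub' ((hP.sub hN).sub hL |>.congr (Eventually.of_forall fun x => by
      simp only [Pi.sub_apply]; push_cast; ring)) hI,
    mellinIoi_sub' ((hP.sub hN).congr (Eventually.of_forall fun x => by simp only [Pi.sub_apply]; push_cast; ring)) hL,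
    mellinIoi_sub' hP hN, mellinIoi_const_mul, mellinIoi_primePowerPi hs, mellinIoi_truncLi hs, ← mellinIoi_ell,
    mellinIoi_indicator_Ici_two (by linarith)]
  ring

/-! ### The transform of the affine modifications `η (C₀ − x T₂(max(x,2))) + M` on `σ > 1` -/

/-- Absolute convergence of the transform of `x ↦ η (C₀ − x T₂(max(x,2))) + M` at every `σ > 1` (`η, C₀, M` real).
[cite: Zhao2025MertensMean, §3 (proof of Thm 1, necessity, i = 2)] -/
theorem integrableOn_affine_piLiTail_rpow (η C₀ M : ℝ) {σ : ℝ} (hσ : 1 < σ) :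
    IntegrableOn (fun x : ℝ => (η * (C₀ - x * ∫ t in Ioi (max x 2), ((Nat.primeCounting ⌊t⌋₊ : ℝ) - logIntegral t) / t ^ 2) + M) *
      x ^ (-(σ + 1))) (Ioi 1) :=
  integrableOn_add_rpow (g := fun _ : ℝ => M)
    (integrableOn_const_mul_rpow η (integrableOn_sub_rpow (f := fun _ : ℝ => C₀) (integrableOn_const_rpow _ (by linarith))
      (integrableOn_mul_piLiTail_rpow hσ)))
    (integrableOn_const_rpow _ (by linarith))

/-- **The transform of `η (C₀ − x T₂(max(x,2))) + M`** on `σ > 1` (with `C₀ = 2T₂(2)` this is the transform of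
`η ∫₂^x E₂ + M` for `x ≥ 2`, by (2.5)): `η (C₀/s − (M₂(s) − T₂(2))/(1 − s)) + M/s` — the source's `∫ A₂(x) x^{-s} dx` display,
for the affine modifications needed for "arbitrarily large positive and negative values". [cite: Zhao2025MertensMean, §3 (the transform of A₂)] -/
theorem mellinIoi_affine_piLiTail (η C₀ M : ℝ) {s : ℂ} (hs : 1 < s.re) :
    mellinIoi (fun x : ℝ => η * (C₀ - x * ∫ t in Ioi (max x 2), ((Nat.primeCounting ⌊t⌋₊ : ℝ) - logIntegral t) / t ^ 2) + M) s =
      η * ((C₀ : ℂ) / s -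
        ((∫ t in Ioi (2 : ℝ), (((Nat.primeCounting ⌊t⌋₊ : ℝ) - logIntegral t : ℝ) : ℂ) * (t : ℂ) ^ (-(s + 1))) -
          ((∫ t in Ioi (2 : ℝ), ((Nat.primeCounting ⌊t⌋₊ : ℝ) - logIntegral t) / t ^ 2 : ℝ) : ℂ)) / (1 - s)) + M / s := by
  have hc := integrable_ofReal_mul_cpow (g := fun _ : ℝ => C₀) measurable_const (σ₁ := s.re / 2)
    (s := s) (integrableOn_const_rpow _ (by linarith)) (by linarith)
  have hm := integrable_ofReal_mul_cpow
    (g := fun x : ℝ => x * ∫ t in Ioi (max x 2), ((Nat.primeCounting ⌊t⌋₊ : ℝ) - logIntegral t) / t ^ 2)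
    (measurable_id.mul measurable_piLiTail_max) (σ₁ := (1 + s.re) / 2) (s := s)
    (integrableOn_mul_piLiTail_rpow (by linarith)) (by linarith)
  have hL := integrable_ofReal_mul_cpow
    (g := fun x : ℝ => η * (C₀ - x * ∫ t in Ioi (max x 2), ((Nat.primeCounting ⌊t⌋₊ : ℝ) - logIntegral t) / t ^ 2))
    ((measurable_const.sub (measurable_id.mul measurable_piLiTail_max)).const_mul η) (σ₁ := (1 + s.re) / 2) (s := s)
    (integrableOn_const_mul_rpow η (integrableOn_sub_rpow (f := fun _ : ℝ => C₀) (integrableOn_const_rpow _ (by linarith))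
      (integrableOn_mul_piLiTail_rpow (by linarith)))) (by linarith)
  have hM := integrable_ofReal_mul_cpow (g := fun _ : ℝ => M) measurable_const (σ₁ := s.re / 2)
    (s := s) (integrableOn_const_rpow _ (by linarith)) (by linarith)
  rw [mellinIoi_add' hL hM, mellinIoi_const_mul, mellinIoi_sub' hc hm, mellinIoi_const _ (by linarith),
    mellinIoi_const _ (by linarith), mellinIoi_mul_piLiTail hs]

end Zhao2025

end Literature.NumberTheory.LFunctions
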